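import Literature.NumberTheory.GaloisRepresentations.HomDualShaTwoConnecting
import Literature.NumberTheory.GaloisRepresentations.KummerSES
import Literature.NumberTheory.GaloisRepresentations.ContinuousCupProductCompat
import HarnessLib

/-!
# The Ш²-cochain bridge, instantiation (the global `2`-cochain `H`): `dH = F ∪ γ` for the connecting cocycle `F` of `Ψ h`,
# from `H³(K, μₙ) = 0` through the Kummer inclusion `μₙ ↪ K̄ˣ` (step S2-inst (H) of SHA2-BRIDGE-w3g7)

Route `SemiOrdinaryEisensteinDescent` (BSD), Kolyvagin column, Cassels–Tate lane: print item `CasselsTateLevelInputsFact`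
(stmt-BirchSwinnertonDyer-20191), last input `hPTc`.  Sequel of `…ShaTwoCochainBridgeData` (p638692: the global bridge data
`h̃, ξ, ξ̃, F, γ̃, c, B` on road B's objects).  S2a's `bridgeCocycle_mem` (p634550) needs one more global datum: a `K̄ˣ`-valued
`2`-cochain `H` with `dH = F ∪ γ` pointwise, `F` the `Hom(M, K̄ˣ)`-valued connecting cocycle.  Here it is PRODUCED from the
displayed hypothesis `H³(K, μₙ) = 0` (for THE application `n = p^{2M₀}`, `p` odd, this is the tree theorem
`galoisCohomology_three_mu_eq_zero_of_ne_two`): pull `F` back to `E^D = Hom(M, μₙ)` along `e⁻¹` (`e = tateDualUnitsIso`), kill the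
`μₙ`-valued `3`-cocycle `F♭ ∪ γ` (`threeCocycleClass_eq_zero_iff_dTwo`), and push the primitive `H♭` forward along the Kummer
inclusion `kummerι : μₙ → K̄ˣ` (additive and equivariant, so `d(ι ∘ H♭) = ι ∘ dH♭`; `ι ∘ F♭(σ,τ) = F(σ,τ)` because
`e = homMuUnits = (ι ∘ ·)`).

* **`exists_bridgeH`** — `∃ H : C(Γ_K², K̄ˣ), ∀ σ τ υ, F(σ,τ)(στ γ(υ)) = (dH)(σ,τ,υ)` — the hypothesis `hH` of `bridgeCocycle_mem`.

Width seat `bsd-wall-soed-p2-w3` g7; `--supports stmt-BirchSwinnertonDyer-20480`, helper.  THEOREMS ONLY; no case of BSD,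
Poitou–Tate or Cassels–Tate is proved here.

## References
* [MilneADT2006] J. S. Milne, *Arithmetic Duality Theorems*, 2nd ed. (2006), I §0, Thm. 4.10 (a)(c), §6 proof of Prop. 6.9
  ("`dβ₁ ∪ β'` represents an element of `H³`, but this group is zero").
* [SerreGaloisCohomology1997] J.-P. Serre, *Galois Cohomology* (1997), II §1.2 (Kummer), II §4.4 Prop. 13.
-/

noncomputable section

-- `Summit.<P>.<Sub>` repeats `BirchSwinnertonDyer` by the tree's layout convention (D-0017)
set_option linter.dupNamespace false
set_option autoImplicit false

namespace Summit.BirchSwinnertonDyer.BirchSwinnertonDyer.Theorems.ShaTwoCochain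

open CategoryTheory NumberField
open Literature.NumberTheory.GaloisRepresentations Literature.NumberTheory.GaloisRepresentations.HomDual
open Literature.Algebra.Homology Literature.Algebra.Homology.DiscreteRep ContRepresentation Field Literature
open Literature.NumberTheory.GaloisRepresentations.DiscreteGaloisModule (units UnitsCarrier mu MuCarrier TateDual tateDual
  tateDualPairing tateDualEval)
open scoped ContRepresentation

-- (H) holds over ANY field `K` (no `NumberField`, no `NeZero n` needed): it is pure Galois-cohomological bookkeeping.
variable {K : Type} [Field K]
variable {M : Type} [AddCommGroup M] [TopologicalSpace M] [DiscreteTopology M] [Finite M]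
variable (ρ : DiscreteGaloisModule K M) (n : ℕ) (hM : ∀ m : M, n • m = 0)

include hM in
/-- **The global `2`-cochain `H` with `dH = F ∪ γ`**, from `H³(K, μₙ) = 0` (displayed hypothesis `hH3`), for ANY `Hom(M, K̄ˣ)`-valued
continuous `2`-cocycle `F` of the finite `n`-torsion module `M` and any `1`-cocycle `γ` of `M` — verbatim the hypothesis `hH` of
`ShaTwoCochain.bridgeCocycle_mem` (`ρZ := ρ`, `ρU := units K`). [cite: MilneADT2006, I §6, proof of Prop. 6.9; Thm. 4.10 (c)]
[cite: SerreGaloisCohomology1997, II §1.2] -/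
theorem exists_bridgeH (hH3 : ∀ z : galoisCohomology (mu K n) 3, z = 0)
    (F : contTwoCocycles (homGaloisModule ρ (units K)).toTopRep) (γ : contOneCocycles ρ.toTopRep) :
    ∃ H : C(absoluteGaloisGroup K × absoluteGaloisGroup K, UnitsCarrier K), ∀ σ τ υ : absoluteGaloisGroup K,
      (show M →ₗ[ℤ] UnitsCarrier K from F.1 (σ, τ)) (ρ (σ * τ) (γ.1 υ)) = dTwo (units K).toTopRep H σ τ υ := by
  haveI := absoluteGaloisGroup_compactSpace K
  -- `F♭ := e⁻¹ ∘ F`, a `2`-cocycle of `M^D = Hom(M, μₙ)`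
  let Fb : contTwoCocycles (ρ.tateDual n).toTopRep :=
    contTwoCocycles.pullback (ContinuousMonoidHom.id _) (resIdHom (tateDualUnitsIso K ρ n hM).inv) F
  -- `e (F♭(σ,τ)) = F(σ,τ)`, pointwise `ι (F♭(σ,τ) m) = F(σ,τ) m`
  have hFb : ∀ (σ τ : absoluteGaloisGroup K) (m : M),
      (kummerι K n).hom ((Fb.1 (σ, τ)) m) = (show M →ₗ[ℤ] UnitsCarrier K from F.1 (σ, τ)) m := by
    intro σ τ m
    have e1 : (tateDualUnitsIso K ρ n hM).hom.hom ((tateDualUnitsIso K ρ n hM).inv.hom (F.1 (σ, τ))) = F.1 (σ, τ) := by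
      rw [← TopRep.comp_apply, (tateDualUnitsIso K ρ n hM).inv_hom_id]
      rfl
    have e2 := congrArg (fun Φ : DiscreteRep.HomCarrier M (UnitsCarrier K) => (show M →ₗ[ℤ] UnitsCarrier K from Φ) m) e1
    exact e2
  -- the `μₙ`-valued `3`-cocycle `F♭ ∪ γ` is a coboundary
  obtain ⟨Hb, hHb⟩ := (threeCocycleClass_eq_zero_iff_dTwo _ _).1
    (hH3 (threeCocycleClass _ (((tateDualPairing ρ n).flip).cupCocycle₂₁ Fb γ)))
  -- push forward along the Kummer inclusion
  refine ⟨⟨fun q => (kummerι K n).hom (Hb q), (kummerι K n).hom.toContinuousLinearMap.continuous.comp Hb.continuous⟩,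
    fun σ τ υ => ?_⟩
  have hι : ∀ x, (units K) σ ((kummerι K n).hom x) = (kummerι K n).hom ((mu K n) σ x) :=
    fun x => (ContinuousRep.hom_comm_apply (kummerι K n) σ x).symm
  have hd : dTwo (units K).toTopRep ⟨fun q => (kummerι K n).hom (Hb q),
      (kummerι K n).hom.toContinuousLinearMap.continuous.comp Hb.continuous⟩ σ τ υ =
      (kummerι K n).hom (dTwo (mu K n).toTopRep Hb σ τ υ) := by
    simp only [dTwo_apply, ContinuousMap.coe_mk, map_sub, map_add, ContinuousRep.toContRepresentation_apply_apply, hι]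
  rw [hd, ← hHb, ContPairing.cupCocycle₂₁_apply, ContPairing.flip_toLin_apply, contOneCocycles.apply_mul_sub]
  exact (hFb σ τ _).symm

end Summit.BirchSwinnertonDyer.BirchSwinnertonDyer.Theorems.ShaTwoCochain

end
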